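import Summits.NavierStokesRegularity.FluidComputer.ClayBlowupRows
import HarnessLib

/-!
# Forced classical continuation from a Clay datum under an A-PRIORI sup bound (the `L^∞` door)

Cell `ns-blowup`, seat `ns-palasek-19179-p2` (g3; holder of record of the crux `EpisodeBase` of the route
`PalasekTowerBreakdown`, item stmt-NavierStokesRegularity-19179, line `slot` v5, stub `stub_explicit_slice_run`). LABEL: E–C
typing (KERNEL — no named fact). WHAT THIS IS NOT: not Navier–Stokes evidence — a CONDITIONAL existence statement (its
hypothesis is an a-priori bound nobody has proved for any design); nothing is constructed.

The registered stub of 19179 asks for SOME classical finite-energy run of a design on the first growth window, below the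
cap `(5/3)·Y₁`, meeting the level-1 read-outs. A certificate — numerical or pen-and-paper — never delivers «∃ a classical
solution» directly: it proves BOUNDS on the solution FOR AS LONG AS IT EXISTS, and existence on the whole window is then
the continuation theorem. This file is that theorem for the FORCED Clay class, in the form the route needs (from `t = 0`,
ONE a-priori sup bound on every finite-energy classical piece of the evolution inside `[0, T₁]`):

* `ClayEvolution.exists_classical_Icc_of_apriori_bound` — `ν > 0`, Clay datum `u₀`, Clay force `f`, `T₁ > 0`, and ONE
  number `M` bounding the speed of EVERY finite-energy classical solution `(u, p)` on `[0, T'] × ℝ³` from `u₀`, for every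
  `T' ∈ (0, T₁]` ⇒ there IS a finite-energy classical solution on `[0, T₁] × ℝ³` from `u₀`, bounded by `M`.

Proof (three tree bricks, no analysis redone): the Clay dichotomy `ClayEvolution.exists_claySolution_or_clayBlowup`
(ecbridge-2: either a global Clay-class solution or a `ClayBlowup` with these data) — in the first case restrict to
`[0, T₁]` (`isNavierStokesSolution_and_smooth_iff`); in the second, if the lifespan `T` exceeds `T₁` restrict the blow-up
(`ClayBlowup.classical_Icc`, `.energy`), and if `T ≤ T₁` every closed sub-slab `[0, T']`, `T' < T`, is a piece inside the
window, so the a-priori bound makes the blow-up BOUNDED on `[0, T) × ℝ³` — against `ClayBlowup.velocity_unbounded` (the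
`L^∞` blow-up criterion: forced half-open continuation, Tao's forced local theory F2, all theorems of the tree).

References: T. Tao, Anal. PDE 6 (2013), Thm. 5.4 (ii)+(iv) [cite: Tao2011, Thm. 5.4 (ii)+(iv)]; P. G. Lemarié-Rieusset,
*The Navier–Stokes Problem in the 21st Century* (2016), Thm. 11.2 [cite: LemarieRieusset2016, Thm. 11.2];
J. Leray, Acta Math. 63 (1934) (3.16) [cite: Leray1934, (3.16)].
-/

noncomputable section

namespace Summit.NavierStokesRegularity.FluidComputer

open Set MeasureTheory Filter Topology Function
open scoped ENNReal ContDiff NNReal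
open Literature.Analysis.FluidPDE
open Summit.NavierStokesRegularity.NavierStokesRegularity

namespace ClayEvolution

variable {ν : ℝ} {f : ℝ → EuclideanSpace ℝ (Fin 3) → EuclideanSpace ℝ (Fin 3)}
  {u₀ : EuclideanSpace ℝ (Fin 3) → EuclideanSpace ℝ (Fin 3)}

/-- **FORCED CLASSICAL CONTINUATION UNDER AN A-PRIORI SUP BOUND (from a Clay datum).** Let `ν > 0`, `u₀` a Clay
datum (smooth, divergence free, rapidly decaying), `f` a Clay force, `T₁ > 0`, and suppose ONE number `M` bounds the
speed of every finite-energy classical solution of the forced system on `[0, T'] × ℝ³` starting from `u₀`, for every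
`T' ∈ (0, T₁]`. Then the forced system HAS a finite-energy classical solution on `[0, T₁] × ℝ³` from `u₀`, and it is
bounded by `M`. (Clay dichotomy + the `L^∞` blow-up criterion `ClayBlowup.velocity_unbounded`.)
[cite: LemarieRieusset2016, Thm. 11.2] [cite: Tao2011, Thm. 5.4 (ii)+(iv)] -/
theorem exists_classical_Icc_of_apriori_bound (hν : 0 < ν) (hu₀ : ContDiff ℝ ∞ u₀)
    (hdiv : NSWave0.IsDivFree u₀) (hdec : HasRapidSpatialDecay u₀) (hs : IsSmoothOnHalfSpace f)
    (hd : HasRapidSpaceTimeDecay f) {T₁ M : ℝ} (hT₁ : 0 < T₁)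
    (hM : ∀ T' ∈ Ioc 0 T₁,
      ∀ (u : ℝ → EuclideanSpace ℝ (Fin 3) → EuclideanSpace ℝ (Fin 3)) (p : ℝ → EuclideanSpace ℝ (Fin 3) → ℝ),
        IsClassicalNSSolutionOn (Icc 0 T') ν f u p → u 0 = u₀ →
        (∃ C : ℝ≥0∞, C < ⊤ ∧ ∀ t ∈ Icc 0 T', ∫⁻ x, ‖u t x‖ₑ ^ 2 ≤ C) →
        ∀ t ∈ Icc 0 T', ∀ x, ‖u t x‖ ≤ M) :
    ∃ (u : ℝ → EuclideanSpace ℝ (Fin 3) → EuclideanSpace ℝ (Fin 3)) (p : ℝ → EuclideanSpace ℝ (Fin 3) → ℝ),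
      IsClassicalNSSolutionOn (Icc 0 T₁) ν f u p ∧ u 0 = u₀ ∧
      (∃ C : ℝ≥0∞, C < ⊤ ∧ ∀ t ∈ Icc 0 T₁, ∫⁻ x, ‖u t x‖ₑ ^ 2 ≤ C) ∧
      ∀ t ∈ Icc 0 T₁, ∀ x, ‖u t x‖ ≤ M := by
  rcases exists_claySolution_or_clayBlowup hν hu₀ hdiv hdec hs hd with ⟨u, p, hus, hps, hns, hE⟩ | ⟨X, hX0, hXf⟩
  · -- a global Clay-class solution: restrict it to `[0, T₁]`
    obtain ⟨hcl, h0⟩ := isNavierStokesSolution_and_smooth_iff.1 ⟨hns, hus, hps⟩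
    have hcl₁ : IsClassicalNSSolutionOn (Icc 0 T₁) ν f u p :=
      hcl.mono Icc_subset_Ici_self (uniqueDiffOn_Icc hT₁)
    have hE₁ : ∃ C : ℝ≥0∞, C < ⊤ ∧ ∀ t ∈ Icc 0 T₁, ∫⁻ x, ‖u t x‖ₑ ^ 2 ≤ C := by
      obtain ⟨C, hC, hb⟩ := hE
      exact ⟨C, hC, fun t ht => hb t ht.1⟩
    exact ⟨u, p, hcl₁, h0, hE₁, hM T₁ ⟨hT₁, le_rfl⟩ u p hcl₁ h0 hE₁⟩
  · -- a Clay blow-up with these data: its lifespan exceeds `T₁`, or it would be bounded on `[0, T)`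
    by_cases hT : T₁ < X.T
    · have hcl₁ : IsClassicalNSSolutionOn (Icc 0 T₁) ν f X.u X.p := by
        have := X.classical_Icc hT₁ hT
        rwa [hXf] at this
      have hE₁ := X.energy T₁ hT
      exact ⟨X.u, X.p, hcl₁, hX0, hE₁, hM T₁ ⟨hT₁, le_rfl⟩ X.u X.p hcl₁ hX0 hE₁⟩
    · exfalso
      have hXT : X.T ≤ T₁ := not_lt.1 hT
      refine X.velocity_unbounded hν ⟨M, fun t ht x => ?_⟩
      -- the piece `[0, T']`, `T' = (t + T)/2 < T ≤ T₁`, lies inside the window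
      set T' : ℝ := (t + X.T) / 2 with hT'
      have htT' : t < T' := by rw [hT']; linarith [ht.2]
      have hT'T : T' < X.T := by rw [hT']; linarith [ht.2]
      have hT'0 : 0 < T' := lt_of_le_of_lt ht.1 htT'
      have hcl' : IsClassicalNSSolutionOn (Icc 0 T') ν f X.u X.p := by
        have := X.classical_Icc hT'0 hT'T
        rwa [hXf] at this
      exact hM T' ⟨hT'0, hT'T.le.trans hXT⟩ X.u X.p hcl' hX0 (X.energy T' hT'T) t ⟨ht.1, htT'.le⟩ x

end ClayEvolution

end Summit.NavierStokesRegularity.FluidComputer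

end
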